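import Literature.Probability.Percolation.ArmSeparationFenceBound
import HarnessLib

/-!
# Rerouting an arm along the exploration sequence: the fenced arm behind side `0`

Topic: Probability / Percolation; family `crit-perc`. The deterministic conclusion of Kesten's
separation step for ONE arm landing on side `0` of `∂Λ_{2M}` (Nolin 2008, §4.4, end of the proof
of Lemma 15 [arXiv 0711.4948: Lemma 14]: "We now assume that `𝒞` is `η`-well-separated, and
prove that any other set of disjoint crossings can also be made `η`-well-separated. … If we take
`c'₁` for instance, it has to cross at least one of the `c_v` (by maximality of `𝒞`) … replace
[its tip] with the corresponding piece of `c_{v₁}` … it is connected to the small extension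
`c̃_{v₁}`"), assembled from the bricks

* `ArmSeparationTrapezoid.lean` — the trapezoid `trapD M` behind side `0` as a `JDomain`;
* `TriLowestCrossing.lean` — the exploration sequence `lowestSeq` and its maximality
  `JDomain.exists_lowestSeq_inter_nonempty` (every open crossing meets a term);
* `ArmSeparationFenceBound.lean` — the per-term success event `TrapFenceOK` (fence + protection)
  and the failure events `TrapSeqFail`, `{lowestSeq T ≠ none}` whose probabilities are bounded
  there.

`trap_reroute`: if the exploration sequence of `trapDomain M` in `ω` stops before `T` and no term
`u < T` fails (`¬ TrapSeqFail M u k₀ K ω`), then every open `𝕋`-path of the annulus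
`{n ≤ |v| ≤ 2M}` ending on side `0` (`trapO M`) can be REROUTED: from its start there is an open
path of the annulus, continued through the fence zone `trapFrameZone M z k` of some tip
`z ∈ trapO M` at some scale `k = k₀ · 32^j`, `j < K`, to a site `m` of an open vertical crossing
of the corner box `[2M+k, 2M+2k] × [z₁+k, z₁+2k]` outside `Λ_{2M}` — and `z` is protected from
above at scale `8k` (no closed path of the trapezoid from a top-type site of the inner box to
outside the outer box). The closed arm is handled by the same statement for `ωᶜ`
(`trap_reroute_closed`).

Proof: the final segment of the path after its last visit to `{v₀ ≤ M}` is an open path of the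
trapezoid from `trapI` to `trapO`; it contains an open crossing (`JDomain.exists_crossing_subset`),
which meets a term `(c, z) = lowestSeq ω u` (maximality); `u < T` since the sequence has stopped
at `T`; the term does not fail, so `TrapFenceOK M c z k ω` holds at some scale; follow the path to
the meeting site, the (connected, open) crossing `c` to the start of the fence connection, and
the connection to `m`.

## References

* P. Nolin, *Near-critical percolation in two dimensions*, Electron. J. Probab. 13 (2008), §4.4,
  proof of Lemma 15 [arXiv 0711.4948: Lemma 14, last paragraph]. [Nolin2008]
* H. Kesten, *Scaling relations for 2D-percolation*, Comm. Math. Phys. 109 (1987), Lemma 2. [Kesten1987]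
-/

noncomputable section

open Set

namespace Literature.Probability.Percolation

open LatticeModels

/-- **The annulus of sites `{n ≤ |v|_𝕋 ≤ N}`** as a set (the region of the arms of `armEvent`,
cf. `mem_armEvent_one_iff_exists_pathIn`). [cite: SmirnovWerner2001, §3] -/
def triAnnSet (n N : ℕ) : Set (Site 2) := {v | (n : ℤ) ≤ triNorm v ∧ triNorm v ≤ N}

/-- Membership in the annulus, unfolded. [folklore] -/
@[simp] theorem mem_triAnnSet {n N : ℕ} {v : Site 2} : v ∈ triAnnSet n N ↔ (n : ℤ) ≤ triNorm v ∧ triNorm v ≤ N :=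
  Iff.rfl

/-- The trapezoid behind side `0` of `∂Λ_{2M}` lies in the annulus `{n ≤ |v| ≤ 2M}` for `n ≤ M`. [folklore] -/
theorem trapD_subset_triAnnSet {M n : ℕ} (hnM : n ≤ M) : (↑(trapD M) : Set (Site 2)) ⊆ triAnnSet n (2 * M) := by
  intro v hv
  have h := mem_trapD_iff_triNorm.1 (Finset.mem_coe.1 hv)
  have h0 : v 0 ≤ triNorm v := by rw [triNorm_eq_max]; simp only [le_max_iff]; exact Or.inl (Or.inl le_rfl)
  refine ⟨?_, by push_cast; exact h.2⟩
  have : (n : ℤ) ≤ M := by exact_mod_cast hnM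
  omega

/-- **The fenced, protected tip** at scale `k` in `ω`: an open vertical crossing of the corner
box `[z₀+k, z₀+2k] × [z₁+k, z₁+2k]` through `m`, and protection from above at scale `8k` (no closed
path of the trapezoid from a top-type boundary site of the inner box of half-width `8k` about
`z` to outside the box of half-width `16k`). [cite: Nolin2008, §4.2 Def. 6 (free spaces) (arXiv 0711.4948)] -/
def TrapTipOK (M : ℕ) (z : Site 2) (k : ℕ) (ω : SiteConfig (Site 2)) (m : Site 2) : Prop :=
  OpenVCrossThrough (triStrip (z 0 + k) (z 1 + k) k k) (z 1 + k) (z 1 + 2 * k) ω m ∧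
    ∀ q t : Site 2, q ∈ (trapDomain M).Tp ∪ (trapDomain M).Jabove z →
      (z 0 - 8 * k ≤ q 0 ∧ q 0 ≤ z 0 + 8 * k ∧ z 1 - 8 * k ≤ q 1 ∧ q 1 ≤ z 1 + 8 * k) →
      (t 0 ≤ z 0 - 16 * k ∨ z 0 + 16 * k ≤ t 0 ∨ t 1 ≤ z 1 - 16 * k ∨ z 1 + 16 * k ≤ t 1) →
      ¬ PathIn triGraph ((↑(trapD M) : Set (Site 2)) ∩ ωᶜ) q t

/-- The sites of a path inside a subset of the trapezoid, as a `Finset`. [folklore] -/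
theorem exists_finset_coe_eq {M : ℕ} {S : Set (Site 2)} (hS : S ⊆ ↑(trapD M)) :
    ∃ S' : Finset (Site 2), S' ⊆ trapD M ∧ (↑S' : Set (Site 2)) = S := by
  classical
  refine ⟨(trapD M).filter fun v => v ∈ S, Finset.filter_subset _ _, ?_⟩
  ext v
  simp only [Finset.coe_filter, Set.mem_setOf_eq]
  exact ⟨fun h => h.2, fun h => ⟨Finset.mem_coe.1 (hS h), h⟩⟩

/-- **Rerouting an open arm landing on side `0`** (Nolin 2008, end of the proof of Lemma 15:
"it has to cross at least one of the `c_v` (by maximality of `𝒞`) … replace [its tip] with the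
corresponding piece of `c_{v₁}` … connected to the small extension `c̃_{v₁}`"). If the
exploration sequence of `trapDomain M` in `ω` has stopped at `T` and no term `u < T` fails, then
from the start `a` (with `a₀ ≤ M`) of any open path of the annulus `{n ≤ |v| ≤ 2M}` (`n ≤ M`)
ending on `trapO M` there is an open path of the annulus continued through a fence zone
`trapFrameZone M z k` (`z ∈ trapO M`, `k = k₀ · 32^j`, `j < K`) to a fenced, protected tip
(`TrapTipOK`). [cite: Nolin2008, §4.4 Lemma 15 (proof) (arXiv 0711.4948: Lemma 14)] -/
theorem trap_reroute {M n T k₀ K : ℕ} (hnM : n ≤ M) {ω : SiteConfig (Site 2)}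
    (hT : (trapDomain M).lowestSeq ω T = none) (hOK : ∀ u < T, ¬ TrapSeqFail M u k₀ K ω)
    {a y : Site 2} (ha0 : a 0 ≤ M) (hy : y ∈ trapO M) (hpath : PathIn triGraph (triAnnSet n (2 * M) ∩ ω) a y) :
    ∃ z ∈ trapO M, ∃ j < K, ∃ m : Site 2, TrapTipOK M z (trapScale k₀ j) ω m ∧
      PathIn triGraph ((triAnnSet n (2 * M) ∪ trapFrameZone M z (trapScale k₀ j)) ∩ ω) a m ∧
      PathIn triGraph (triAnnSet n (2 * M) ∩ ω) a z := by
  classical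
  have hcut := trapDomain_cutProp M
  have hy' := trapO_coord hy
  have hM1 : (M : ℤ) < 2 * M := by have := mem_trapD.1 (mem_trapO.1 hy).1; omega
  -- a tight support of the whole path
  obtain ⟨S₀, hS₀, hp₀, ht₀⟩ := hpath.exists_support
  -- the final segment after the last visit to `{v₀ ≤ M}`
  set C : Set (Site 2) := {v | v 0 ≤ M} with hC
  have hyC : y ∉ C := fun h => by simp only [hC, Set.mem_setOf_eq] at h; omega
  obtain ⟨p, q, hpC, -, hqC, hpq, hσ⟩ := hp₀.last_exit (C := C) ha0 hyC
  simp only [hC, Set.mem_setOf_eq, not_le] at hpC hqC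
  have hq0 : q 0 = (M : ℤ) + 1 := by have := (triGraph_adj_coord hpq 0).2; omega
  -- its sites are open sites of the trapezoid
  have hσD : ∀ v ∈ S₀ \ C, v ∈ (↑(trapD M) : Set (Site 2)) ∩ ω := by
    rintro v ⟨hv, hvC⟩
    simp only [hC, Set.mem_setOf_eq, not_le] at hvC
    have h := hS₀ hv
    exact ⟨Finset.mem_coe.2 (mem_trapD_of_triNorm_le hvC h.1.2), h.2⟩
  obtain ⟨S₁, hS₁, hp₁, ht₁⟩ := hσ.exists_support
  have hS₁D : S₁ ⊆ ↑(trapD M) := fun v hv => (hσD v (hS₁ hv)).1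
  obtain ⟨S₁', -, hcoe⟩ := exists_finset_coe_eq hS₁D
  have hqI : q ∈ trapI M := mem_trapI.2 ⟨Finset.mem_coe.1 (hS₁D hp₁.left_mem), hq0⟩
  -- an open crossing inside it, and a term of the exploration sequence meeting that crossing
  obtain ⟨c', w, hc', hc'S⟩ := (trapDomain M).exists_crossing_subset (S := S₁')
    (fun v hv => Finset.mem_coe.1 (hS₁D (hcoe ▸ Finset.mem_coe.2 hv))) hqI hy (hcoe ▸ hp₁)
  have hc'S₁ : (↑c' : Set (Site 2)) ⊆ S₁ := hcoe ▸ Finset.coe_subset.2 hc'S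
  have hc'ω : (↑c' : Set (Site 2)) ⊆ ω := fun v hv => (hσD v (hS₁ (hc'S₁ hv))).2
  obtain ⟨u, c, z, hu, x, hx⟩ := JDomain.exists_lowestSeq_inter_nonempty hcut hc' hc'ω
  rw [Finset.mem_inter] at hx
  obtain ⟨hc, hcω⟩ := JDomain.isCrossing_of_lowestSeq hu
  -- the sequence has stopped at `T`, so `u < T`, and the term does not fail
  have huT : u < T := by
    by_contra h
    rw [JDomain.lowestSeq_eq_none_of_le hT (not_lt.1 h)] at hu
    exact absurd hu (by simp)
  have hok : ∃ j < K, TrapFenceOK M c z (trapScale k₀ j) ω := by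
    by_contra hno
    exact hOK u huT ⟨c, z, hu, fun j hj hj' => hno ⟨j, hj, hj'⟩⟩
  obtain ⟨j, hj, ⟨m, hmV, s, hsc, hsm⟩, hprot⟩ := hok
  refine ⟨z, hc.tip_mem_J, j, hj, m, ⟨hmV, hprot⟩, ?_⟩
  -- assemble `a → q → x → s → m`
  set A : Set (Site 2) := (triAnnSet n (2 * M) ∪ trapFrameZone M z (trapScale k₀ j)) ∩ ω with hA
  have hS₀A : S₀ ⊆ A := fun v hv => ⟨Or.inl (hS₀ hv).1, (hS₀ hv).2⟩
  have hS₁A : S₁ ⊆ A := fun v hv => hS₀A (hS₁ hv).1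
  have hcA : (↑c : Set (Site 2)) ⊆ A := fun v hv =>
    ⟨Or.inl (trapD_subset_triAnnSet hnM (Finset.mem_coe.2 (hc.subset (Finset.mem_coe.1 hv)))), hcω hv⟩
  have h1 : PathIn triGraph A a q := (ht₀ q (hS₁ hp₁.left_mem).1).mono hS₀A
  have h2 : PathIn triGraph A q x := (ht₁ x (hc'S₁ (Finset.mem_coe.2 hx.1))).mono hS₁A
  have h3 : PathIn triGraph A x s := (hc.conn x hx.2 s hsc).mono hcA
  have h4 : PathIn triGraph A s m := hsm.mono fun v hv => ⟨Or.inr hv.1, hv.2⟩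
  refine ⟨((h1.trans h2).trans h3).trans h4, ?_⟩
  -- and `a → q → x → z` inside the annulus (the tip is a site of the connected open crossing `c`)
  have hS₀B : S₀ ⊆ triAnnSet n (2 * M) ∩ ω := hS₀
  have hcB : (↑c : Set (Site 2)) ⊆ triAnnSet n (2 * M) ∩ ω := fun v hv =>
    ⟨trapD_subset_triAnnSet hnM (Finset.mem_coe.2 (hc.subset (Finset.mem_coe.1 hv))), hcω hv⟩
  exact (((ht₀ q (hS₁ hp₁.left_mem).1).mono hS₀B).trans ((ht₁ x (hc'S₁ (Finset.mem_coe.2 hx.1))).mono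
    fun v hv => hS₀B (hS₁ hv).1)).trans ((hc.conn x hx.2 z hc.tip_mem).mono hcB)

/-- **Rerouting a closed arm landing on side `0`**: the same statement for the closed colour,
i.e. `trap_reroute` applied to the complementary configuration `ωᶜ` (the failure events being
those of `ωᶜ`). [cite: Nolin2008, §4.4 Lemma 15 (proof) (arXiv 0711.4948: Lemma 14)] -/
theorem trap_reroute_closed {M n T k₀ K : ℕ} (hnM : n ≤ M) {ω : SiteConfig (Site 2)}
    (hT : (trapDomain M).lowestSeq ωᶜ T = none) (hOK : ∀ u < T, ¬ TrapSeqFail M u k₀ K ωᶜ)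
    {a y : Site 2} (ha0 : a 0 ≤ M) (hy : y ∈ trapO M) (hpath : PathIn triGraph (triAnnSet n (2 * M) ∩ ωᶜ) a y) :
    ∃ z ∈ trapO M, ∃ j < K, ∃ m : Site 2, TrapTipOK M z (trapScale k₀ j) ωᶜ m ∧
      PathIn triGraph ((triAnnSet n (2 * M) ∪ trapFrameZone M z (trapScale k₀ j)) ∩ ωᶜ) a m ∧
      PathIn triGraph (triAnnSet n (2 * M) ∩ ωᶜ) a z :=
  trap_reroute hnM hT hOK ha0 hy hpath

end Literature.Probability.Percolation
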